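import Literature.NumberTheory.Automorphic.VanDijkTraceParabolicIndGLProof
import Literature.NumberTheory.Automorphic.Zelevinsky1980.MaximalParabolicOpenCellRadical
import Summits.HodgeConjecture.HodgeConjecture.Theorems.F0P3bVanDijkSplitOfGL
import HarnessLib

/-!
# Line «CMCharIdentityTest» (F0P3b), stub `stub_vanDijkGL` (ED. 8/9) — PAID: van Dijk's formula at the split place, by instantiation of ★ `GLn.vanDijkTraceParabolicIndGL_holds`

Cell `pub/hodgecm-mathlib`, crux H413 = `stmt-HodgeConjecture-24833`; line file `Cruxes/H413/Lines/F0_P3b_CMCharIdentityTestPaydown.lean` ED. 9 :278.  THEOREMS ONLY (no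
definition, no instance, no notation, no named fact, no `sorry`); kernel lane `--supports stmt-HodgeConjecture-24833 --as helper`.  HONEST LABEL: HC_CM is proved only modulo the
printed citations (2 remaining named inputs hLiu418, h413) until rung 0 closes; this file pays the GL-currency statement `stub_vanDijkGL` of the line, whence (b)
`stub_vanDijkSplit` (★ `F0P3bVanDijkSplitOfGL.vanDijkSplit_of_vanDijkGL'`) becomes unconditional.

* `isHaarMeasure_map_cmSplitLeviHom` — the push-forward of a Haar measure on `H_v = U(Φ₂) × U(Φ₁)` along `jj = cmSplitLeviHom` (a topological-group isomorphism onto the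
  closed Levi `M_{(2,1)}(L_w)`: continuous ★, onto by ★ `exists_continuousMulEquiv_prod_standardLeviGL_twoBlock`, proper as a closed embedding) is a Haar measure on `↥M`.
* **`vanDijkGL`** `: <text of stub_vanDijkGL VERBATIM>` — `GLn.vanDijkTraceParabolicIndGL_holds` at `F = L_w`, `c = lastBlockLabel 3` (monotone, ★ `monotone_lastBlockLabel`),
  `χ = maxParabolicLeviChar L_w 3 (ξ.splitν₀ μ w) (ξ.locψ w)` (open kernel: ★ `Liu2021.SplitPlace.isOpen_ker_maxParabolicLeviChar` ∘ ★ `isOpen_ker_of_continuous`),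
  `ν = e′_* νG_v` (★ `ContinuousMulEquiv.isHaarMeasure_map`), `νM = jj_* νH_v`.

## References
* [vanDijk1972] G. van Dijk, *Computation of certain induced characters of 𝔭-adic groups*, Math. Ann. 199 (1972), 229–240.
* [BernsteinZelevinsky1977] I. N. Bernstein, A. V. Zelevinsky, *Induced representations of reductive 𝔭-adic groups I*, §2.3.
* [Rogawski1990] J. D. Rogawski, *Automorphic Representations of Unitary Groups in Three Variables* (1990), §4.13 Lemma 4.13.1 (b) p. 64.
-/

set_option autoImplicit false
set_option linter.dupNamespace false

noncomputable section

open NumberField IsDedekindDomain MeasureTheory MeasureTheory.Measure Topology Filter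
open scoped Matrix MatrixGroups
open Literature.NumberTheory.Rogawski1990 Literature.NumberTheory.Automorphic Literature.NumberTheory.Automorphic.UnitaryGroup
open Literature.NumberTheory.GaloisRepresentations Literature.NumberTheory.Automorphic.Arthur2013.Leaves.TECR
open Literature.NumberTheory.Automorphic.Zelevinsky1980

namespace Summit.HodgeConjecture.HodgeConjecture.Cruxes.H413.F0P3bVanDijkGL

variable (L : Type) [Field L] [NumberField L] [IsCMField L] (v : HeightOneSpectrum (𝓞 ↥(maximalRealSubfield L)))
  (w : PlacesOver L v) (hw : IsCMField.complexConj L • w.1 ≠ w.1)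

/-- **`jj = cmSplitLeviHom` is onto the Levi `M_{(2,1)}(L_w)`** (★ `exists_continuousMulEquiv_prod_standardLeviGL_twoBlock` in the `[2 ≤ i]` labelling = ★ `lastBlockLabel 3`,
and `e₂`, `e₁` are bijections). [cite: Rogawski1990, §4.13 p. 64] [cite: BernsteinZelevinsky1977, §2.1] -/
theorem cmSplitLeviHom_surjective : Function.Surjective (cmSplitLeviHom L v w hw) := by
  intro m
  obtain ⟨E0, hE0⟩ := exists_continuousMulEquiv_prod_standardLeviGL_twoBlock (S := w.1.adicCompletion L) (k := 2) (l := 1)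
  have hm : (m : GL (Fin 3) (w.1.adicCompletion L)) ∈ standardLeviGL (w.1.adicCompletion L) (fun i : Fin (2 + 1) => decide (2 ≤ (i : ℕ))) := by
    rw [← lastBlockLabel_three_eq]; exact m.2
  set x := E0.symm ⟨(m : GL (Fin 3) (w.1.adicCompletion L)), hm⟩ with hx
  refine ⟨((cmSplitEquivTwo L v w hw).symm x.1, (cmSplitEquivOne L v w hw).symm x.2), Subtype.ext ?_⟩
  rw [coe_cmSplitLeviHom_apply, cmSplitLeviGL_apply]
  simp only [ContinuousMulEquiv.apply_symm_apply, Prod.mk.eta]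
  rw [← hE0 x, hx, ContinuousMulEquiv.apply_symm_apply]

/-- **`jj` is a closed embedding** (a homeomorphism of `H_v` onto the closed subgroup `M_{(2,1)}(L_w)` of `GL₃(L_w)`). [cite: BernsteinZelevinsky1977, §2.1] -/
theorem isClosedEmbedding_cmSplitLeviHom : IsClosedEmbedding (cmSplitLeviHom L v w hw) := by
  haveI := (IsNonarchimedeanLocalField.isLocalField (w.1.adicCompletion L)).toT2Space
  obtain ⟨E0, hE0⟩ := exists_continuousMulEquiv_prod_standardLeviGL_twoBlock (S := w.1.adicCompletion L) (k := 2) (l := 1)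
  have hφ : IsClosedEmbedding (fun x : GL (Fin 2) (w.1.adicCompletion L) × GL (Fin 1) (w.1.adicCompletion L) =>
      UnitaryGroup.reindexGL finSumFinEquiv (UnitaryGroup.blockDiagGL x)) := by
    have h1 : (fun x : GL (Fin 2) (w.1.adicCompletion L) × GL (Fin 1) (w.1.adicCompletion L) =>
        UnitaryGroup.reindexGL finSumFinEquiv (UnitaryGroup.blockDiagGL x)) = Subtype.val ∘ E0 := funext fun x => (hE0 x).symm
    rw [h1]
    exact (IsClosed.isClosedEmbedding_subtypeVal (isClosed_standardLeviGL _)).comp E0.toHomeomorph.isClosedEmbedding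
  have hψ : IsClosedEmbedding (cmSplitLeviGL L v w hw) := by
    have h2 : (cmSplitLeviGL L v w hw : _ → GL (Fin 3) (w.1.adicCompletion L)) =
        (fun x : GL (Fin 2) (w.1.adicCompletion L) × GL (Fin 1) (w.1.adicCompletion L) =>
          UnitaryGroup.reindexGL finSumFinEquiv (UnitaryGroup.blockDiagGL x)) ∘
          (fun h => (cmSplitEquivTwo L v w hw h.1, cmSplitEquivOne L v w hw h.2)) := rfl
    rw [h2]
    exact hφ.comp ((cmSplitEquivTwo L v w hw).toHomeomorph.prodCongr (cmSplitEquivOne L v w hw).toHomeomorph).isClosedEmbedding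
  refine ⟨hψ.isEmbedding.codRestrict _ (cmSplitLeviGL_mem_standardLeviGL L v w hw), ?_⟩
  have hrange : Set.range (cmSplitLeviHom L v w hw) = Subtype.val ⁻¹' Set.range (cmSplitLeviGL L v w hw) := by
    ext m
    constructor
    · rintro ⟨h, rfl⟩; exact ⟨h, rfl⟩
    · rintro ⟨h, hh⟩; exact ⟨h, Subtype.ext hh⟩
  rw [hrange]
  exact hψ.isClosed_range.preimage continuous_subtype_val

/-- **`jj_* νH` is a Haar measure on `↥M_{(2,1)}(L_w)`** for a Haar measure `νH` on `H_v` (Mathlib `isHaarMeasure_map` for the continuous, surjective, proper homomorphism `jj`).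
[cite: BernsteinZelevinsky1977, §2.1] -/
theorem isHaarMeasure_map_cmSplitLeviHom
    [MeasurableSpace ((cmDatum L 2 (Matrix.of fun i j : Fin 2 => if i.val + j.val + 1 = 2 then (1 : L) else 0)).Local v ×
      (cmDatum L 1 (Matrix.of fun i j : Fin 1 => if i.val + j.val + 1 = 1 then (1 : L) else 0)).Local v)]
    [BorelSpace ((cmDatum L 2 (Matrix.of fun i j : Fin 2 => if i.val + j.val + 1 = 2 then (1 : L) else 0)).Local v ×
      (cmDatum L 1 (Matrix.of fun i j : Fin 1 => if i.val + j.val + 1 = 1 then (1 : L) else 0)).Local v)]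
    [MeasurableSpace (GL (Fin 3) (w.1.adicCompletion L))] [BorelSpace (GL (Fin 3) (w.1.adicCompletion L))]
    (νH : Measure ((cmDatum L 2 (Matrix.of fun i j : Fin 2 => if i.val + j.val + 1 = 2 then (1 : L) else 0)).Local v ×
      (cmDatum L 1 (Matrix.of fun i j : Fin 1 => if i.val + j.val + 1 = 1 then (1 : L) else 0)).Local v)) [νH.IsHaarMeasure] :
    (Measure.map (cmSplitLeviHom L v w hw) νH).IsHaarMeasure :=
  isHaarMeasure_map νH (cmSplitLeviHom L v w hw) (continuous_cmSplitLeviHom L v w hw) (cmSplitLeviHom_surjective L v w hw)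
    (isClosedEmbedding_cmSplitLeviHom L v w hw).tendsto_cocompact

set_option maxHeartbeats 1600000 in
/-- **`stub_vanDijkGL` PAID** — van Dijk's trace formula [vanDijk1972; BernsteinZelevinsky1977 §2.3; Rogawski1990 4.13.1 (b) «standard»] for `Ind_{P_{(2,1)}}^{GL₃(L_w)}(ν₀ ∘ det ⊠ ψ_w)` at
the measures `(e′_* νG_v, jj_* νH_v)`, in the line's (b)-frame: the text of `stub_vanDijkGL` (ED. 9 :278) VERBATIM, by instantiation of ★ `GLn.vanDijkTraceParabolicIndGL_holds`.
[cite: Rogawski1990, §4.13 Lemma 4.13.1 (b) p. 64] [cite: BernsteinZelevinsky1977, §2.3] -/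
theorem vanDijkGL :
    ∀ (L : Type) [Field L] [NumberField L] [IsCMField L] (H : Matrix (Fin 3) (Fin 3) L) (μ : HeckeCharacter L)
      [∀ v : HeightOneSpectrum (𝓞 ↥(maximalRealSubfield L)), MeasurableSpace
        ((cmDatum L 2 (Matrix.of fun i j : Fin 2 => if i.val + j.val + 1 = 2 then (1 : L) else 0)).Local v ×
          (cmDatum L 1 (Matrix.of fun i j : Fin 1 => if i.val + j.val + 1 = 1 then (1 : L) else 0)).Local v)]
      [∀ v : HeightOneSpectrum (𝓞 ↥(maximalRealSubfield L)), BorelSpace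
        ((cmDatum L 2 (Matrix.of fun i j : Fin 2 => if i.val + j.val + 1 = 2 then (1 : L) else 0)).Local v ×
          (cmDatum L 1 (Matrix.of fun i j : Fin 1 => if i.val + j.val + 1 = 1 then (1 : L) else 0)).Local v)]
      [∀ v : HeightOneSpectrum (𝓞 ↥(maximalRealSubfield L)), MeasurableSpace ((cmDatum L 3 H).Local v)]
      [∀ v : HeightOneSpectrum (𝓞 ↥(maximalRealSubfield L)), BorelSpace ((cmDatum L 3 H).Local v)]
      (νH : ∀ v : HeightOneSpectrum (𝓞 ↥(maximalRealSubfield L)), Measure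
        ((cmDatum L 2 (Matrix.of fun i j : Fin 2 => if i.val + j.val + 1 = 2 then (1 : L) else 0)).Local v ×
          (cmDatum L 1 (Matrix.of fun i j : Fin 1 => if i.val + j.val + 1 = 1 then (1 : L) else 0)).Local v))
      (νG : ∀ v : HeightOneSpectrum (𝓞 ↥(maximalRealSubfield L)), Measure ((cmDatum L 3 H).Local v))
      [∀ v, (νH v).IsHaarMeasure] [∀ v, (νH v).IsMulRightInvariant] [∀ v, (νG v).IsHaarMeasure] [∀ v, (νG v).IsMulRightInvariant]
      (hμu : μ.IsUnitary)
      (_hμω : ∀ x : Literature.NumberTheory.GaloisRepresentations.ideleGroup ↥(maximalRealSubfield L),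
        μ (AdeleRing.ideleBaseChange (↥(maximalRealSubfield L)) L x) = quadraticHeckeCharCM L x)
      (hherm : (H.map (cmConjRingHom L))ᵀ = H)
      (hanis : ∀ x : Fin 3 → L, Literature.AlgebraicGeometry.ShimuraVarieties.hermForm (cmConjRingHom L) H x x = 0 → x = 0)
      (ξ : OneDimAutRepH L) (v : HeightOneSpectrum (𝓞 ↥(maximalRealSubfield L)))
      (hs : ∃ w : PlacesOver L v, IsCMField.complexConj L • w.1 ≠ w.1),
      letI : MeasurableSpace (GL (Fin 3) ((splitWitness v hs).1.adicCompletion L)) := borel _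
      VanDijkTraceParabolicIndGL ((splitWitness v hs).1.adicCompletion L) (lastBlockLabel 3)
        (maxParabolicLeviChar ((splitWitness v hs).1.adicCompletion L) 3 (ξ.splitν₀ μ (splitWitness v hs).1) (ξ.locψ (splitWitness v hs).1))
        (Measure.map (cmSplitEquiv L H hherm (isUnit_iff_ne_zero.mpr (Godement.det_ne_zero_of_anisotropic L H hanis)) v (splitWitness v hs)
          (splitWitness_spec v hs)) (νG v))
        (Measure.map (cmSplitLeviHom L v (splitWitness v hs) (splitWitness_spec v hs)) (νH v)) := by
  intro L _ _ _ H μ _ _ _ _ νH νG _ _ _ _ hμu _hμω hherm hanis ξ v hs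
  letI : MeasurableSpace (GL (Fin 3) ((splitWitness v hs).1.adicCompletion L)) := borel _
  haveI : BorelSpace (GL (Fin 3) ((splitWitness v hs).1.adicCompletion L)) := ⟨rfl⟩
  haveI : (Measure.map (cmSplitEquiv L H hherm (isUnit_iff_ne_zero.mpr (Godement.det_ne_zero_of_anisotropic L H hanis)) v (splitWitness v hs)
      (splitWitness_spec v hs)) (νG v)).IsHaarMeasure := ContinuousMulEquiv.isHaarMeasure_map (νG v) _
  haveI := isHaarMeasure_map_cmSplitLeviHom L v (splitWitness v hs) (splitWitness_spec v hs) (νH v)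
  exact GLn.vanDijkTraceParabolicIndGL_holds (F := (splitWitness v hs).1.adicCompletion L) (monotone_lastBlockLabel 3)
    (maxParabolicLeviChar ((splitWitness v hs).1.adicCompletion L) 3 (ξ.splitν₀ μ (splitWitness v hs).1) (ξ.locψ (splitWitness v hs).1))
    (Liu2021.SplitPlace.isOpen_ker_maxParabolicLeviChar 3 _ _
      (Liu2021.SplitPlace.isOpen_ker_of_continuous _ (ξ.continuous_splitν₀ μ (splitWitness v hs).1))
      (Liu2021.SplitPlace.isOpen_ker_of_continuous _ (ξ.continuous_locψ (splitWitness v hs).1))) _ _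

end Summit.HodgeConjecture.HodgeConjecture.Cruxes.H413.F0P3bVanDijkGL

end
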